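import Summits.Ventures.PercRepro.Night2ShapeOneCross
import Summits.Ventures.PercRepro.Night2ShapeOneCheck

/-!
# PercRepro — the seven-point shape (i): the assembly, part A (night-2, gen 30)

Helpers of the assembly Night2ShapeOneMainB: the sum of the good-target loads over `S` reduces to the six points of the
two lines (`sum_gtLoadAt_eq_lines`: the coloop `w` and the coloop of `G` are never sources); a face request is `0` or
`Φ/(m + 2)` (`faceReq_cases`), hence admissible in the sharp sense of the finite check (`faceReq_adm`); and the FAT RULE
of the check follows from «at most one fat closure» once the seven closures are pairwise distinct and every request
`7/24` certifies a fat closure (`fatRule_of_distinct`).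
-/

namespace PercRepro.Shadow

open Finset PerFlat ThmH

variable {α : Type*} [DecidableEq α] {M : Matroid α} [M.Finite] {G : Finset α}

section MainA

open scoped Classical in
/-- **The sources are on the two lines**: the load of the coloop `w` and of the coloop of `G` vanish, so the sum over
`S` is the sum over `R₁ ∪ R₂`. -/
theorem sum_gtLoadAt_eq_lines (hG : G ∈ flatsQ M (5 + 1)) (hd : (gr M \ G).card = 2)
    (hk : kColoops M G = 1) (hs : ∀ e ∈ gr M, ∀ f ∈ gr M, e ≠ f → rkN M {e, f} = 2)
    (hl : ∀ e ∈ gr M, M.Indep {e}) {S : Finset α} (hSG : S ⊆ G) {w : α}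
    (hc : coloops M (S \ coloops M G) = {w}) {R₁ R₂ : Finset α} (hV : S \ coloops M G = insert w (R₁ ∪ R₂))
    (hw₁ : w ∉ R₁) (hw₂ : w ∉ R₂) :
    ∑ y ∈ S, gtLoadAt M 5 G (bigP M G) (S.erase y) y = ∑ y ∈ R₁ ∪ R₂, gtLoadAt M 5 G (bigP M G) (S.erase y) y := by
  have hd' : (gr M \ G).card ≤ 5 := by omega
  have hwc : w ∈ coloops M (S \ coloops M G) := by rw [hc]; exact Finset.mem_singleton_self _
  have hsub : R₁ ∪ R₂ ⊆ S := by
    intro a ha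
    have : a ∈ S \ coloops M G := by rw [hV]; exact Finset.mem_insert_of_mem ha
    exact (Finset.mem_sdiff.1 this).1
  symm
  apply Finset.sum_subset hsub
  intro y hyS hyR
  apply gtLoadAt_eq_zero_of_faceLossP_eq_zero
  intro w' hw'
  by_contra hne
  -- `y` is a source: not in `K` (a thin face contains `K`), and not the coloop `w`
  have hyK : y ∉ coloops M G := by
    intro hK
    obtain ⟨hthin, -, -, -⟩ := faceLossP_structure hne
    exact (Finset.notMem_erase y S) ((Finset.erase_subset _ _) (coloops_subset_of_mem_thinMembers hG hd' hthin hK))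
  have hyV : y ∈ S \ coloops M G := Finset.mem_sdiff.2 ⟨hyS, hyK⟩
  rw [hV, Finset.mem_insert] at hyV
  rcases hyV with rfl | hyV
  · exact hne (faceLossP_eq_zero_of_mem_coloops hG hd hk hs hl hSG hwc hw')
  · exact hyR hyV

/-- A face request is `0` or `Φ(5)/(m + 2)`. -/
theorem faceReq_cases (F : Finset α) :
    faceReq M G F = 0 ∨ faceReq M G F = phiQ 5 / (((G \ clF M F).card : ℚ) + 2) := by
  unfold faceReq
  split_ifs
  · exact Or.inr rfl
  · exact Or.inl rfl

/-- `Φ(5)/(m + 2) = ρ(m)`. -/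
theorem phiQ_div_eq_rhoReq (m : ℕ) : phiQ 5 / ((m : ℚ) + 2) = rhoReq m := by
  unfold phiQ rhoReq; norm_num

/-- **A face request is admissible in the sharp sense**: with `m = |G ∖ cl F| = 2 + s`, `0 ≤ r`, `r ≤ ρ(2 + s)` when
`s ≥ 1`, and `r ∈ {0, 7/24}` when `s = 0`. -/
theorem faceReq_adm {F : Finset α} {s : ℕ} (hm : (G \ clF M F).card = 2 + s) :
    0 ≤ faceReq M G F ∧ (1 ≤ s → faceReq M G F ≤ rhoReq (2 + s)) ∧
      (s = 0 → faceReq M G F = 0 ∨ faceReq M G F = 7 / 24) := by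
  rcases faceReq_cases (M := M) (G := G) F with h | h
  · rw [h]
    refine ⟨le_refl _, fun _ => rhoReq_nonneg _, fun _ => Or.inl rfl⟩
  · rw [h, hm]
    push_cast
    rw [show ((2 : ℚ) + (s : ℚ) + 2) = ((2 + s : ℕ) : ℚ) + 2 by push_cast; ring, phiQ_div_eq_rhoReq]
    refine ⟨rhoReq_nonneg _, fun _ => le_refl _, fun hs => Or.inr ?_⟩
    rw [hs, rhoReq_two]

/-- **The fat rule** (the form of the finite check) from «at most one fat closure»: every request `7/24` certifies a
fat closure among seven pairwise distinct closures. -/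
theorem fatRule_of_distinct (hfat : (fatClosures M 5 G 2).card ≤ 1) {CH C₁ C₂ C₃ D₁ D₂ D₃ : Finset α}
    {rH r₁ r₂ r₃ u₁ u₂ u₃ : ℚ}
    (fH : rH = 7 / 24 → CH ∈ fatClosures M 5 G 2) (f₁ : r₁ = 7 / 24 → C₁ ∈ fatClosures M 5 G 2)
    (f₂ : r₂ = 7 / 24 → C₂ ∈ fatClosures M 5 G 2) (f₃ : r₃ = 7 / 24 → C₃ ∈ fatClosures M 5 G 2)
    (g₁ : u₁ = 7 / 24 → D₁ ∈ fatClosures M 5 G 2) (g₂ : u₂ = 7 / 24 → D₂ ∈ fatClosures M 5 G 2)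
    (g₃ : u₃ = 7 / 24 → D₃ ∈ fatClosures M 5 G 2)
    (dH₁ : CH ≠ C₁) (dH₂ : CH ≠ C₂) (dH₃ : CH ≠ C₃) (dH₄ : CH ≠ D₁) (dH₅ : CH ≠ D₂) (dH₆ : CH ≠ D₃)
    (d₁₂ : C₁ ≠ C₂) (d₁₃ : C₁ ≠ C₃) (d₁₄ : C₁ ≠ D₁) (d₁₅ : C₁ ≠ D₂) (d₁₆ : C₁ ≠ D₃)
    (d₂₃ : C₂ ≠ C₃) (d₂₄ : C₂ ≠ D₁) (d₂₅ : C₂ ≠ D₂) (d₂₆ : C₂ ≠ D₃)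
    (d₃₄ : C₃ ≠ D₁) (d₃₅ : C₃ ≠ D₂) (d₃₆ : C₃ ≠ D₃) (d₄₅ : D₁ ≠ D₂) (d₄₆ : D₁ ≠ D₃) (d₅₆ : D₂ ≠ D₃) :
    (rH = 7 / 24 → r₁ ≠ 7 / 24 ∧ r₂ ≠ 7 / 24 ∧ r₃ ≠ 7 / 24 ∧ u₁ ≠ 7 / 24 ∧ u₂ ≠ 7 / 24 ∧ u₃ ≠ 7 / 24) ∧
      (r₁ = 7 / 24 → r₂ ≠ 7 / 24 ∧ r₃ ≠ 7 / 24 ∧ u₁ ≠ 7 / 24 ∧ u₂ ≠ 7 / 24 ∧ u₃ ≠ 7 / 24) ∧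
      (r₂ = 7 / 24 → r₃ ≠ 7 / 24 ∧ u₁ ≠ 7 / 24 ∧ u₂ ≠ 7 / 24 ∧ u₃ ≠ 7 / 24) ∧
      (r₃ = 7 / 24 → u₁ ≠ 7 / 24 ∧ u₂ ≠ 7 / 24 ∧ u₃ ≠ 7 / 24) ∧ (u₁ = 7 / 24 → u₂ ≠ 7 / 24 ∧ u₃ ≠ 7 / 24) ∧
      (u₂ = 7 / 24 → u₃ ≠ 7 / 24) := by
  have two : ∀ {A B : Finset α}, A ∈ fatClosures M 5 G 2 → B ∈ fatClosures M 5 G 2 → A ≠ B → False :=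
    fun hA hB hAB => hAB (eq_of_mem_fatClosures_of_card_le_one hfat hA hB)
  refine ⟨fun h => ⟨?_, ?_, ?_, ?_, ?_, ?_⟩, fun h => ⟨?_, ?_, ?_, ?_, ?_⟩, fun h => ⟨?_, ?_, ?_, ?_⟩,
    fun h => ⟨?_, ?_, ?_⟩, fun h => ⟨?_, ?_⟩, fun h => ?_⟩ <;> intro h'
  · exact two (fH h) (f₁ h') dH₁
  · exact two (fH h) (f₂ h') dH₂
  · exact two (fH h) (f₃ h') dH₃
  · exact two (fH h) (g₁ h') dH₄
  · exact two (fH h) (g₂ h') dH₅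
  · exact two (fH h) (g₃ h') dH₆
  · exact two (f₁ h) (f₂ h') d₁₂
  · exact two (f₁ h) (f₃ h') d₁₃
  · exact two (f₁ h) (g₁ h') d₁₄
  · exact two (f₁ h) (g₂ h') d₁₅
  · exact two (f₁ h) (g₃ h') d₁₆
  · exact two (f₂ h) (f₃ h') d₂₃
  · exact two (f₂ h) (g₁ h') d₂₄
  · exact two (f₂ h) (g₂ h') d₂₅
  · exact two (f₂ h) (g₃ h') d₂₆
  · exact two (f₃ h) (g₁ h') d₃₄
  · exact two (f₃ h) (g₂ h') d₃₅
  · exact two (f₃ h) (g₃ h') d₃₆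
  · exact two (g₁ h) (g₂ h') d₄₅
  · exact two (g₁ h) (g₃ h') d₄₆
  · exact two (g₂ h) (g₃ h') d₅₆

end MainA

end PercRepro.Shadow
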